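import Summits.Schanuel.Schanuel.Theorems.TateNomesTateLocusGPCOneTwoNomeTransfer

/-!
# Line skeleton `Sketch` (s-dual second cusp) for the crux `TateLocusGPCOne` (stmt-Schanuel-17406)

Crux (route `TateNomes`, decl `Summit.Schanuel.Schanuel.Theses.TateNomes.TateLocusGPCOne`): for
`Im τ > 0`, `τ` not a root of a monic rational quadratic,
`5 ≤ trdeg_ℚ ℚ(2πi, τ, q, P(q), Q(q), R(q))`, `q = e^{2πiτ}`.

The line (card `Cruxes/TateLocusGPCOne/Ideas/s-dual-second-cusp.md`, ideator 2; the same transfer is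
card `fricke-partner-nome`, ideator 1): adjoin the S-partner nome `q' = e^{2πi(−1/τ)}`.  The level-one
transformation laws `E₄(−1/τ) = τ⁴E₄(τ)`, `E₆(−1/τ) = τ⁶E₆(τ)`, `E₂(−1/τ) = τ²E₂(τ) + 12τ/(2πi)`
put `P(q'), Q(q'), R(q')` inside `ℚ(2πi, τ, P(q), Q(q), R(q))`, so the field of the EIGHT cusp-values
`(q, P, Q, R)(q) ∪ (q, P, Q, R)(q')` lies in the crux field with `q'` adjoined and
`trdeg ℚ(eight) ≤ trdeg ℚ(six) + 1`.  This transfer is LANDED (p158095, tree file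
`Summits/Schanuel/Schanuel/Theorems/TateNomesTateLocusGPCOneTwoNomeTransfer.lean`:
`ramanujanP/Q/R_partner`, `adjoin_twoNome_le`, `trdeg_twoNome_le`, `tateLocusGPCOne_of_twoNome`).
Hence the pure-nome statement "`6 ≤ trdeg ℚ(eight)` for non-quadratic `τ`" (`stub_twoNomeS`, = GPC
for `h¹(E_τ) ⊕ [ℤ² → 𝔾_m; (q, q')]`, OPEN) implies the crux: `TateLocusGPCOne_of`.

Composition: `TateLocusGPCOne_of := tateLocusGPCOne_of_twoNome stub_twoNomeS` (by name).
Stubs: `stub_twoNomeS` — the only one; hardest; an open problem strictly stronger than the crux (no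
two-point transcendence engine beyond Nesterenko's `3` per nome exists; the card's two-cusp scheme is
capped at smallness exponent `4`, output `3`, by the cusp-budget count, against the `7` needed).
-/

noncomputable section

-- single-conjunct summit: `Summit.Schanuel.Schanuel.…` repeats the name by the D-0017 layout
set_option linter.dupNamespace false

open Complex IntermediateField
open scoped Real
open Literature.Barriers.Schanuel (ramanujanP ramanujanQ ramanujanR)

namespace Summit.Schanuel.Schanuel.Theorems.TateNomesTateLocusGPCOne

/-- **stub_twoNomeS** — the two-nome (S-partner) statement `C_S`: for `Im τ > 0`, `τ` non-quadratic,
`6 ≤ trdeg_ℚ ℚ(q, P(q), Q(q), R(q), q', P(q'), Q(q'), R(q'))`, `q = e^{2πiτ}`, `q' = e^{−2πi/τ}`.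
GPC (dim `G_mot = 6`) for `h¹(E_τ) ⊕ [ℤ² → 𝔾_m; (q, q')]`; strictly stronger than the crux. OPEN. -/
theorem stub_twoNomeS :
    ∀ τ : ℂ, 0 < τ.im → (∀ b c : ℚ, τ ^ 2 + (b : ℂ) * τ + (c : ℂ) ≠ 0) →
      (6 : Cardinal) ≤ Algebra.trdeg ℚ ↥(adjoin ℚ ({cexp (2 * π * I * τ),
        ramanujanP (cexp (2 * π * I * τ)), ramanujanQ (cexp (2 * π * I * τ)),
        ramanujanR (cexp (2 * π * I * τ)), cexp (2 * π * I * (-τ⁻¹)),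
        ramanujanP (cexp (2 * π * I * (-τ⁻¹))), ramanujanQ (cexp (2 * π * I * (-τ⁻¹))),
        ramanujanR (cexp (2 * π * I * (-τ⁻¹)))} : Set ℂ)) := by
  sorry

/-- **Composition**: the line closes the crux BY NAME modulo `stub_twoNomeS`. -/
theorem TateLocusGPCOne_of : Summit.Schanuel.Schanuel.Theses.TateNomes.TateLocusGPCOne :=
  tateLocusGPCOne_of_twoNome stub_twoNomeS

end Summit.Schanuel.Schanuel.Theorems.TateNomesTateLocusGPCOne

end
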